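/-
Copyright (c) 2026 the pub-hodgecm-mathlib formalisation cell (harness21).  Prover seat hodgecm-mathlib-K2E1-p12 (g7), Track B ∕ R90-TF, h413 = `stmt-HodgeConjecture-24833`,
R90-TF section S8 «ContSpec-n½», socket (E) :276, E1-PLANCHEREL BODY brick PB-2a (S8 dealer R90-CS-plan (g4) S8-R254 (8)+(13), S8-R256 (5); joint census
`R90/S8/CENSUS-PlancherelBody-bricks.K2E1-p16-F0P2-p10.md`): the AXIS-GENERIC contour shift of the two-term inner-product integrand of a pseudo-Eisenstein family — ★ T4b-multi
`K2E1PseudoEisensteinContourShiftMultiCMTwo` (axis `½`, reflection point `1`) re-run once with an arbitrary axis `κ`, reflection point `ρ` and Gram constant `g`, so that the `U(2,1)`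
case (`κ = 1`, `ρ = 2`, `σ₀ > 2`) is an instance.
-/
import Summits.HodgeConjecture.HodgeConjecture.Theorems.K2E1PseudoEisensteinContourShiftMultiCMTwo  -- ★ T4b-multi (K2E4-p11): `not_mem_image_of_re`; brings ★ T4b §1 uniform Mellin bounds (generic), ★ C4-multi `integral_vertical_eq_integral_vertical_add_sum_residues`, ★ T4a, ★ A
import Mathlib.Analysis.Calculus.Deriv.Star                                                      -- Mathlib: `differentiableAt_conj_conj_iff` (Schwarz reflection)
import HarnessLib

/-!
# PB-2a — `K2E1PseudoEisensteinContourShiftAxisGeneric`: the two-term inner-product integrand of a pseudo-Eisenstein family moved from `Re z = σ₀` to an ARBITRARY axis `Re z = κ`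
# across finitely many simple real poles, with an arbitrary reflection point `ρ` and Gram constant `g` (pure analysis, on letters)

Track B ∕ R90-TF, crux h413 = `stmt-HodgeConjecture-24833`, route of record `HCCMUnconditional`; cell `hodgecm-mathlib`, R90-TF programme, section S8 «ContSpec-n½», socket (E)
(B ED. 7 :276): the E1-PLANCHEREL BODY, cut into bricks PB-1…PB-4 (S8-R254); PB-2 = the contour shift producing the Gram identity consumed by PB-3∕PB-4.  THIS FILE = PB-2a, its
scalar analytic engine.  THEOREMS ONLY (no `def`, no `instance`, no `notation`, no named-fact hypothesis, no `sorry`; default heartbeats); lane `--supports stmt-HodgeConjecture-24833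
--as helper` (count-neutral).  No automorphic object.  CLOSES NO SOCKET.

THE MATHEMATICS ([MoeglinWaldspurger1995, II.2.1–II.2.4, IV.1.11]; [Titchmarsh1939, §3.12]; [Titchmarsh1948, §1.29]).  For a rank-one group with `δ_B = H^{ρ}` (`ρ = 1` for `U(1,1)`,
`ρ = 2` for `U(2,1)`; Godement domain `Re z > ρ`, unitary axis `Re z = ρ∕2`) the unfolded inner product of two pseudo-Eisenstein series `θ_{f,φ}`, `θ_{f′,φ′}` with profiles
`f, f′ ∈ C²_c((0,∞))` is, by Mellin–Parseval on the line `Re z = σ₀ > ρ` (PB-1b∕PB-1c; N = 2: ★ `K2E1PseudoEisensteinInnerProductCMTwoFinal`), `C·(2π)⁻¹∫_ℝ F(σ₀+iy) dy` with the TWO-TERM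
INTEGRAND **`F(z) = f̃(−z)·(g·conj(mellin f′ (z̄ − ρ)) + s(z)·conj(mellin f′ (−z̄)))`**, `f̃ = mellin f`, `g = ⟨φ, φ′⟩` the Gram constant of the diagonal bracket and `s(z) = ⟨φ′, M(w₀,z)φ⟩`-type
the meromorphically continued intertwining coefficient.  The three Mellin factors are ENTIRE (★ A `differentiable_mellin`, Schwarz reflection), `f̃(−z)` is `O(|Im z|⁻²)` on vertical
strips uniformly and the conjugated factors are bounded there (★ T4b §1).  ON LETTERS for `s` — holomorphic on an open `U ⊇ {κ ≤ Re z ≤ σ₀}` off a finite set `S ⊂ (κ, σ₀)` of REAL simple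
poles (`hs`), `(z − c)s(z) → r_c` at each `c ∈ S` (`hr`), `‖s z‖ ≤ B` on `κ < Re z ≤ σ₀, |Im z| ≥ 1` (`hB`, Maass–Selberg currency; extended to `Re z = κ` by continuity, §1) — the
integrand meets every hypothesis of ★ C4-multi `integral_vertical_eq_integral_vertical_add_sum_residues` on the strip `[κ, σ₀]`, whence (§3 HEAD) from `hIP : IP = C·((2π)⁻¹∫_ℝ F(σ₀+iy) dy)`:
**`IP = C·(Σ_{c∈S} r_c·f̃(−c)·conj(mellin f′ (−c))) + C·((2π)⁻¹∫_ℝ F(κ+iy) dy)`**, with `y ↦ F(σ+iy) ∈ L¹` on every line of the closed strip off the poles.  At `(κ, ρ, g) = (½, 1, 1)`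
this is ★ T4b-multi's head (up to the spelling `z̄ − 1 = −(1 − z̄)`); at `(κ, ρ) = (1, 2)` it is the `U(2,1)` shift `Re z = σ₀ > 2 → Re z = 1` past `z = 2` (top) and `z = 3∕2` (mid) —
PB-2 of the census; the vector∕operator edition and the `U(2,1)` head ride in PB-2a′ `K2E1PseudoEisensteinContourShiftVectorAxisGeneric`.
* §1 the axis scalar on the closed strip `[κ, σ₀]` off a finset of real poles: closure of the strip bound at `Re z = κ`, continuity on vertical lines.
* §2 the integrand: `differentiable_conj_mellin_conj_sub` (Schwarz), holomorphy off the poles, residues, uniform `O(y⁻²)`, integrability on lines, the shift `integral_twoTermIntegrand_eq_add_sum_residues`.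
* §3 HEAD **`pseudoEisenstein_contourShift_axis_of_letters`**.
HONEST LABEL: HC_CM is proved only modulo the 7 printed citations (2 remaining named inputs: hLiu418 = `stmt-HodgeConjecture-24832`, h413 = `stmt-HodgeConjecture-24833`) until rung 0
closes; this file asserts no named fact, closes no socket; count-neutral; letters `hs∕hr∕hB` (continued intertwining coefficient: holomorphy on a neighbourhood of the closed strip off
real simple poles, residues, strip bound) and `hIP` (PB-1's two-term formula) are hypotheses, not claims.

## References
* [MoeglinWaldspurger1995] C. Mœglin, J.-L. Waldspurger, *Spectral decomposition and Eisenstein series* (1995), II.2.1–II.2.4, IV.1.11.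
* [Titchmarsh1939] E. C. Titchmarsh, *The Theory of Functions* (2nd ed., 1939), §3.12, §4.5.
* [Titchmarsh1948] E. C. Titchmarsh, *Introduction to the Theory of Fourier Integrals* (1948), §1.29.
-/

set_option autoImplicit false
set_option linter.dupNamespace false  -- the mandated namespace repeats the summit's segment (`HodgeConjecture.HodgeConjecture`)

noncomputable section

open MeasureTheory Measure Set Filter Topology Complex
open scoped Real ComplexConjugate
open Summit.HodgeConjecture.HodgeConjecture.Cruxes.H413.K2E1MellinPaleyWienerHalfLine (differentiable_mellin)
open Summit.HodgeConjecture.HodgeConjecture.Cruxes.H413.K2E1VerticalLineContourShift (integrable_of_continuous_of_sq_decay)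
open Summit.HodgeConjecture.HodgeConjecture.Cruxes.H413.K2E1VerticalLineContourShiftMulti (integral_vertical_eq_integral_vertical_add_sum_residues)
open Summit.HodgeConjecture.HodgeConjecture.Cruxes.H413.K2E1PseudoEisensteinContourShiftCMTwo (exists_norm_mellin_le_of_re_mem_Icc exists_norm_mellin_vertical_le_div_sq_of_mem_Icc)
open Summit.HodgeConjecture.HodgeConjecture.Cruxes.H413.K2E1PseudoEisensteinContourShiftMultiCMTwo (not_mem_image_of_re)

namespace Summit.HodgeConjecture.HodgeConjecture.Cruxes.H413.K2E1PseudoEisensteinContourShiftAxisGeneric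

/-! ## §1 The axis scalar on the closed strip `{κ ≤ Re z ≤ σ₀}` off a finite set of real poles in `(κ, σ₀)` -/

section Scalar

variable {s : ℂ → ℂ} {U : Set ℂ} {κ σ₀ B : ℝ} {S : Finset ℝ}

/-- **THE STRIP BOUND EXTENDS TO THE AXIS `Re z = κ`** (finite real pole set in `(κ, σ₀)`): if `s` is holomorphic on `U ∖ S` (`U` open ⊇ the closed strip, the poles real with `κ < c`)
and `‖s z‖ ≤ B` on `κ < Re z ≤ σ₀, |Im z| ≥ 1`, then `‖s z‖ ≤ B` on `κ ≤ Re z ≤ σ₀, |Im z| ≥ 1` (`s(κ+it) = lim_{x↓0} s(κ+x+it)`; the axis-generic twin of ★ T4b-multi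
`norm_le_of_re_mem_Icc_of_finset`). [cite: MoeglinWaldspurger1995, IV.1.11] -/
theorem norm_le_of_re_mem_Icc_axis (hUo : IsOpen U) (hUs : {z : ℂ | κ ≤ z.re ∧ z.re ≤ σ₀} ⊆ U) (hs : DifferentiableOn ℂ s (U \ ((S.image fun c : ℝ => (c : ℂ)) : Set ℂ)))
    (hS : ∀ c ∈ S, κ < c) (hσ₀ : κ < σ₀) (hB : ∀ z : ℂ, κ < z.re → z.re ≤ σ₀ → 1 ≤ |z.im| → ‖s z‖ ≤ B) :
    ∀ z : ℂ, κ ≤ z.re → z.re ≤ σ₀ → 1 ≤ |z.im| → ‖s z‖ ≤ B := by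
  intro z hz₁ hz₂ hzi
  rcases lt_or_eq_of_le hz₁ with h | h
  · exact hB z h hz₂ hzi
  · -- `Re z = κ`: approach from the right
    have hzS : z ∉ ((S.image fun c : ℝ => (c : ℂ)) : Set ℂ) := not_mem_image_of_re fun c hc => by rw [← h]; exact (hS c hc).ne
    have hzU : z ∈ U \ ((S.image fun c : ℝ => (c : ℂ)) : Set ℂ) := ⟨hUs ⟨hz₁, hz₂⟩, hzS⟩
    have hopen : IsOpen (U \ ((S.image fun c : ℝ => (c : ℂ)) : Set ℂ)) := hUo.sdiff (Finset.finite_toSet _).isClosed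
    have hcont : ContinuousAt s z := (hs.differentiableAt (hopen.mem_nhds hzU)).continuousAt
    have hlim : Tendsto (fun x : ℝ => ‖s (z + x)‖) (𝓝[>] 0) (𝓝 ‖s z‖) := by
      have h1 : Tendsto (fun x : ℝ => z + (x : ℂ)) (𝓝 0) (𝓝 z) := by
        have h2 : Continuous fun x : ℝ => z + (x : ℂ) := continuous_const.add continuous_ofReal
        have h3 := h2.tendsto 0
        simpa using h3
      exact ((hcont.tendsto.comp h1).norm).mono_left nhdsWithin_le_nhds
    refine le_of_tendsto hlim ?_
    filter_upwards [Ioo_mem_nhdsGT (show (0 : ℝ) < σ₀ - κ by linarith)] with x hx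
    refine hB _ ?_ ?_ ?_
    · simp only [add_re, ofReal_re]; linarith [hx.1]
    · simp only [add_re, ofReal_re]; linarith [hx.2]
    · simpa only [add_im, ofReal_im, add_zero] using hzi

/-- `y ↦ s(σ+iy)` is continuous for `σ ∈ [κ, σ₀]`, `σ ∉ S` (the line lies in `U ∖ S`). [folklore] -/
theorem continuous_scalar_vertical_axis (hUs : {z : ℂ | κ ≤ z.re ∧ z.re ≤ σ₀} ⊆ U) (hs : DifferentiableOn ℂ s (U \ ((S.image fun c : ℝ => (c : ℂ)) : Set ℂ)))
    {σ : ℝ} (hσ₁ : κ ≤ σ) (hσ₂ : σ ≤ σ₀) (hσ : ∀ c ∈ S, σ ≠ c) : Continuous fun y : ℝ => s ((σ : ℂ) + y * I) := by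
  have hline : ∀ y : ℝ, (σ : ℂ) + y * I ∈ U \ ((S.image fun c : ℝ => (c : ℂ)) : Set ℂ) := fun y =>
    ⟨hUs ⟨by simpa using hσ₁, by simpa using hσ₂⟩, not_mem_image_of_re fun c hc => by simpa using hσ c hc⟩
  exact hs.continuousOn.comp_continuous (continuous_const.add (continuous_ofReal.mul continuous_const)) hline

end Scalar

/-! ## §2 The two-term integrand `F(z) = f̃(−z)·(g·conj(mellin f′ (z̄ − ρ)) + s(z)·conj(mellin f′ (−z̄)))` off a finite set of real poles -/

section Integrand

variable {f f' : ℝ → ℂ} {s : ℂ → ℂ} {U : Set ℂ} {κ σ₀ B : ℝ} {S : Finset ℝ} {r : ℝ → ℂ}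

/-- `z ↦ conj (mellin g (conj z − ρ))` and `z ↦ conj (mellin g (−conj z))` are entire, for ANY `ρ ∈ ℂ` (Schwarz reflection of ★ A `differentiable_mellin`; the axis-generic twin of ★ T4b
`differentiable_conj_mellin_reflect`). [cite: Titchmarsh1939, §4.5] -/
theorem differentiable_conj_mellin_conj_sub {g : ℝ → ℂ} (hgc : Continuous g) (hgs : HasCompactSupport g) (hg0 : tsupport g ⊆ Ioi 0) (ρ : ℂ) :
    Differentiable ℂ (fun z : ℂ => conj (mellin g (conj z - ρ))) ∧ Differentiable ℂ (fun z : ℂ => conj (mellin g (-conj z))) := by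
  have hd := differentiable_mellin hgc hgs hg0
  refine ⟨fun z => ?_, fun z => ?_⟩
  · have h : DifferentiableAt ℂ (conj ∘ (fun w : ℂ => mellin g (w - ρ)) ∘ conj) z :=
      differentiableAt_conj_conj_iff.2 ((hd.comp (differentiable_id.sub (differentiable_const _))).differentiableAt)
    exact h
  · have h : DifferentiableAt ℂ (conj ∘ (fun w : ℂ => mellin g (-w)) ∘ conj) z := differentiableAt_conj_conj_iff.2 ((hd.comp differentiable_neg).differentiableAt)
    exact h

/-- `F` is complex-differentiable wherever `s` is (★ A + Schwarz reflection for the Mellin factors). [cite: MoeglinWaldspurger1995, II.2.2] -/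
theorem differentiableOn_twoTermIntegrand (hf : ContDiff ℝ 2 f) (hfs : HasCompactSupport f) (hf0 : tsupport f ⊆ Ioi 0)
    (hf' : ContDiff ℝ 2 f') (hf's : HasCompactSupport f') (hf'0 : tsupport f' ⊆ Ioi 0) (ρ g : ℂ) {V : Set ℂ} (hs : DifferentiableOn ℂ s V) :
    DifferentiableOn ℂ (fun z : ℂ => mellin f (-z) * (g * conj (mellin f' (conj z - ρ)) + s z * conj (mellin f' (-conj z)))) V := by
  obtain ⟨h2, h3⟩ := differentiable_conj_mellin_conj_sub hf'.continuous hf's hf'0 ρ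
  have h1 : Differentiable ℂ fun z : ℂ => mellin f (-z) := (differentiable_mellin hf.continuous hfs hf0).comp differentiable_neg
  exact h1.differentiableOn.mul (((differentiableOn_const g).mul h2.differentiableOn).add (hs.mul h3.differentiableOn))

/-- **THE RESIDUE AT A REAL POLE `c`**: `(z − c)·F(z) → r_c·f̃(−c)·conj(mellin f′ (−c))` as `z → c`, `z ≠ c` (`(z − c)s(z) → r_c`; the Mellin factors are continuous at `c`, the
`g`-term is entire and contributes nothing; `conj c = c`). [cite: MoeglinWaldspurger1995, II.2.4] -/
theorem tendsto_sub_mul_twoTermIntegrand (hf : ContDiff ℝ 2 f) (hfs : HasCompactSupport f) (hf0 : tsupport f ⊆ Ioi 0)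
    (hf' : ContDiff ℝ 2 f') (hf's : HasCompactSupport f') (hf'0 : tsupport f' ⊆ Ioi 0) (ρ g : ℂ) {c : ℝ} {r₀ : ℂ}
    (hr : Tendsto (fun z : ℂ => (z - c) * s z) (𝓝[≠] (c : ℂ)) (𝓝 r₀)) :
    Tendsto (fun z : ℂ => (z - c) * (mellin f (-z) * (g * conj (mellin f' (conj z - ρ)) + s z * conj (mellin f' (-conj z)))))
      (𝓝[≠] (c : ℂ)) (𝓝 (r₀ * (mellin f (-(c : ℂ)) * conj (mellin f' (-(c : ℂ)))))) := by
  obtain ⟨h2, h3⟩ := differentiable_conj_mellin_conj_sub hf'.continuous hf's hf'0 ρ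
  have h1 : Differentiable ℂ fun z : ℂ => mellin f (-z) := (differentiable_mellin hf.continuous hfs hf0).comp differentiable_neg
  have e : ∀ z : ℂ, (z - c) * (mellin f (-z) * (g * conj (mellin f' (conj z - ρ)) + s z * conj (mellin f' (-conj z)))) =
      mellin f (-z) * ((z - c) * (g * conj (mellin f' (conj z - ρ))) + ((z - c) * s z) * conj (mellin f' (-conj z))) := fun z => by ring
  simp_rw [e]
  have hM1 : Tendsto (fun z : ℂ => mellin f (-z)) (𝓝[≠] (c : ℂ)) (𝓝 (mellin f (-(c : ℂ)))) := tendsto_nhdsWithin_of_tendsto_nhds (h1 c).continuousAt.tendsto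
  have hM2 : Tendsto (fun z : ℂ => (z - c) * (g * conj (mellin f' (conj z - ρ)))) (𝓝[≠] (c : ℂ)) (𝓝 (((c : ℂ) - c) * (g * conj (mellin f' (conj (c : ℂ) - ρ))))) :=
    tendsto_nhdsWithin_of_tendsto_nhds (((continuous_id.sub continuous_const).mul (continuous_const.mul h2.continuous)).tendsto (c : ℂ))
  have hM3 : Tendsto (fun z : ℂ => conj (mellin f' (-conj z))) (𝓝[≠] (c : ℂ)) (𝓝 (conj (mellin f' (-conj (c : ℂ))))) :=
    tendsto_nhdsWithin_of_tendsto_nhds ((h3 (c : ℂ)).continuousAt.tendsto)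
  have h := hM1.mul (hM2.add (hr.mul hM3))
  simp only [sub_self, zero_mul, zero_add, conj_ofReal] at h
  refine h.trans ?_
  rw [show r₀ * (mellin f (-(c : ℂ)) * conj (mellin f' (-(c : ℂ)))) = mellin f (-(c : ℂ)) * (r₀ * conj (mellin f' (-(c : ℂ)))) by ring]

/-- **UNIFORM `O(y⁻²)` OF THE INTEGRAND ON THE CLOSED STRIP**: `∃ K, ‖F(x+iy)‖ ≤ K∕y²` for `x ∈ [κ, σ₀]`, `|y| ≥ 1` — `f̃(−z)` is `O(y⁻²)` uniformly, the conjugated Mellin factors are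
bounded (★ T4b §1, on the strips `Re ∈ [κ − Re ρ, σ₀ − Re ρ]` and `[−σ₀, −κ]`), `‖s‖ ≤ B` there (§1 closure of the strip letter). [cite: MoeglinWaldspurger1995, II.2.2] [cite: Titchmarsh1948, §1.29] -/
theorem exists_norm_twoTermIntegrand_le_div_sq (hf : ContDiff ℝ 2 f) (hfs : HasCompactSupport f) (hf0 : tsupport f ⊆ Ioi 0)
    (hf' : ContDiff ℝ 2 f') (hf's : HasCompactSupport f') (hf'0 : tsupport f' ⊆ Ioi 0) (ρ g : ℂ) (hσ₀ : κ < σ₀)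
    (hUo : IsOpen U) (hUs : {z : ℂ | κ ≤ z.re ∧ z.re ≤ σ₀} ⊆ U) (hs : DifferentiableOn ℂ s (U \ ((S.image fun c : ℝ => (c : ℂ)) : Set ℂ))) (hS : ∀ c ∈ S, κ < c)
    (hB : ∀ z : ℂ, κ < z.re → z.re ≤ σ₀ → 1 ≤ |z.im| → ‖s z‖ ≤ B) :
    ∃ K : ℝ, ∀ x ∈ Icc κ σ₀, ∀ y : ℝ, 1 ≤ |y| →
      ‖mellin f (-((x : ℂ) + y * I)) * (g * conj (mellin f' (conj ((x : ℂ) + y * I) - ρ)) + s ((x : ℂ) + y * I) * conj (mellin f' (-conj ((x : ℂ) + y * I))))‖ ≤ K / y ^ 2 := by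
  obtain ⟨B₁, hB₁0, hB₁⟩ := exists_norm_mellin_vertical_le_div_sq_of_mem_Icc hf hfs hf0 (-σ₀) (-κ)
  obtain ⟨B₂, hB₂0, hB₂⟩ := exists_norm_mellin_le_of_re_mem_Icc hf'.continuous hf's hf'0 (κ - ρ.re) (σ₀ - ρ.re)
  obtain ⟨B₃, hB₃0, hB₃⟩ := exists_norm_mellin_le_of_re_mem_Icc hf'.continuous hf's hf'0 (-σ₀) (-κ)
  have hBc := norm_le_of_re_mem_Icc_axis hUo hUs hs hS hσ₀ hB
  have hB0 : 0 ≤ B := (norm_nonneg _).trans (hB ((σ₀ : ℂ) + (1 : ℝ) * I) (by simp; linarith) (by simp) (by simp))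
  refine ⟨B₁ * (‖g‖ * B₂ + B * B₃), fun x hx y hy => ?_⟩
  have hy0 : y ≠ 0 := fun h => by rw [h, abs_zero] at hy; linarith
  have hy2 : 0 < y ^ 2 := by positivity
  have e1 : -((x : ℂ) + y * I) = ((-x : ℝ) : ℂ) + ((-y : ℝ) : ℂ) * I := by push_cast; ring
  have h1 : ‖mellin f (-((x : ℂ) + y * I))‖ ≤ B₁ / y ^ 2 := by
    rw [e1]
    have h := hB₁ (-x) ⟨by linarith [hx.2], by linarith [hx.1]⟩ (-y) (neg_ne_zero.2 hy0)
    rwa [neg_sq] at h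
  have h2 : ‖conj (mellin f' (conj ((x : ℂ) + y * I) - ρ))‖ ≤ B₂ := by
    rw [RCLike.norm_conj]
    refine hB₂ _ ?_ ?_ <;> simp <;> linarith [hx.1, hx.2]
  have h3 : ‖conj (mellin f' (-conj ((x : ℂ) + y * I)))‖ ≤ B₃ := by
    rw [RCLike.norm_conj]
    refine hB₃ _ ?_ ?_ <;> simp <;> linarith [hx.1, hx.2]
  have h4 : ‖s ((x : ℂ) + y * I)‖ ≤ B := hBc _ (by simpa using hx.1) (by simpa using hx.2) (by simpa using hy)
  calc ‖mellin f (-((x : ℂ) + y * I)) * (g * conj (mellin f' (conj ((x : ℂ) + y * I) - ρ)) + s ((x : ℂ) + y * I) * conj (mellin f' (-conj ((x : ℂ) + y * I))))‖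
      ≤ ‖mellin f (-((x : ℂ) + y * I))‖ * (‖g‖ * ‖conj (mellin f' (conj ((x : ℂ) + y * I) - ρ))‖ + ‖s ((x : ℂ) + y * I)‖ * ‖conj (mellin f' (-conj ((x : ℂ) + y * I)))‖) := by
        rw [norm_mul]
        refine mul_le_mul_of_nonneg_left ((norm_add_le _ _).trans (add_le_add ?_ ?_)) (norm_nonneg _)
        · rw [norm_mul]
        · rw [norm_mul]
    _ ≤ (B₁ / y ^ 2) * (‖g‖ * B₂ + B * B₃) := by
        refine mul_le_mul h1 (add_le_add ?_ ?_) (by positivity) (by positivity)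
        · exact mul_le_mul_of_nonneg_left h2 (norm_nonneg _)
        · exact mul_le_mul h4 h3 (norm_nonneg _) hB0
    _ = B₁ * (‖g‖ * B₂ + B * B₃) / y ^ 2 := by ring

/-- **`y ↦ F(σ+iy)` IS INTEGRABLE for every `σ ∈ [κ, σ₀]` off the poles** (`σ ∉ S`) — continuous (§1) and `O(y⁻²)`: «`F ∈ L¹` explicit», in particular on the axis `σ = κ` and on
`σ = σ₀`. [cite: MoeglinWaldspurger1995, II.2.2] -/
theorem integrable_twoTermIntegrand_vertical (hf : ContDiff ℝ 2 f) (hfs : HasCompactSupport f) (hf0 : tsupport f ⊆ Ioi 0)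
    (hf' : ContDiff ℝ 2 f') (hf's : HasCompactSupport f') (hf'0 : tsupport f' ⊆ Ioi 0) (ρ g : ℂ) (hσ₀ : κ < σ₀)
    (hUo : IsOpen U) (hUs : {z : ℂ | κ ≤ z.re ∧ z.re ≤ σ₀} ⊆ U) (hs : DifferentiableOn ℂ s (U \ ((S.image fun c : ℝ => (c : ℂ)) : Set ℂ))) (hS : ∀ c ∈ S, κ < c)
    (hB : ∀ z : ℂ, κ < z.re → z.re ≤ σ₀ → 1 ≤ |z.im| → ‖s z‖ ≤ B) {σ : ℝ} (hσ₁ : κ ≤ σ) (hσ₂ : σ ≤ σ₀) (hσ : ∀ c ∈ S, σ ≠ c) :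
    Integrable fun y : ℝ => mellin f (-((σ : ℂ) + y * I)) * (g * conj (mellin f' (conj ((σ : ℂ) + y * I) - ρ)) + s ((σ : ℂ) + y * I) * conj (mellin f' (-conj ((σ : ℂ) + y * I)))) := by
  obtain ⟨K, hK⟩ := exists_norm_twoTermIntegrand_le_div_sq hf hfs hf0 hf' hf's hf'0 ρ g hσ₀ hUo hUs hs hS hB
  obtain ⟨h2, h3⟩ := differentiable_conj_mellin_conj_sub hf'.continuous hf's hf'0 ρ
  have h1 : Differentiable ℂ fun z : ℂ => mellin f (-z) := (differentiable_mellin hf.continuous hfs hf0).comp differentiable_neg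
  have hL : Continuous fun y : ℝ => (σ : ℂ) + y * I := continuous_const.add (continuous_ofReal.mul continuous_const)
  refine integrable_of_continuous_of_sq_decay ?_ (hK σ ⟨hσ₁, hσ₂⟩)
  exact (h1.continuous.comp hL).mul ((continuous_const.mul (h2.continuous.comp hL)).add ((continuous_scalar_vertical_axis hUs hs hσ₁ hσ₂ hσ).mul (h3.continuous.comp hL)))

/-- **THE CONTOUR SHIFT OF THE TWO-TERM INTEGRAND ACROSS THE FINSET OF POLES, FROM `Re z = σ₀` TO THE AXIS `Re z = κ`** (★ C4-multi `integral_vertical_eq_integral_vertical_add_sum_residues`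
at `σ₁ = κ`, `σ₂ = σ₀`): `∫_ℝ F(σ₀+iy) dy = ∫_ℝ F(κ+iy) dy + 2π·Σ_{c ∈ S} r_c·f̃(−c)·conj(mellin f′ (−c))`. [cite: MoeglinWaldspurger1995, II.2.4] [cite: Titchmarsh1939, §3.12] -/
theorem integral_twoTermIntegrand_eq_add_sum_residues (hf : ContDiff ℝ 2 f) (hfs : HasCompactSupport f) (hf0 : tsupport f ⊆ Ioi 0)
    (hf' : ContDiff ℝ 2 f') (hf's : HasCompactSupport f') (hf'0 : tsupport f' ⊆ Ioi 0) (ρ g : ℂ) (hσ₀ : κ < σ₀)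
    (hUo : IsOpen U) (hUs : {z : ℂ | κ ≤ z.re ∧ z.re ≤ σ₀} ⊆ U) (hs : DifferentiableOn ℂ s (U \ ((S.image fun c : ℝ => (c : ℂ)) : Set ℂ)))
    (hS : ∀ c ∈ S, κ < c ∧ c < σ₀) (hr : ∀ c ∈ S, Tendsto (fun z : ℂ => (z - c) * s z) (𝓝[≠] (c : ℂ)) (𝓝 (r c)))
    (hB : ∀ z : ℂ, κ < z.re → z.re ≤ σ₀ → 1 ≤ |z.im| → ‖s z‖ ≤ B) :
    ∫ y : ℝ, mellin f (-((σ₀ : ℂ) + y * I)) * (g * conj (mellin f' (conj ((σ₀ : ℂ) + y * I) - ρ)) + s ((σ₀ : ℂ) + y * I) * conj (mellin f' (-conj ((σ₀ : ℂ) + y * I)))) =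
      (∫ y : ℝ, mellin f (-((κ : ℂ) + y * I)) * (g * conj (mellin f' (conj ((κ : ℂ) + y * I) - ρ)) + s ((κ : ℂ) + y * I) * conj (mellin f' (-conj ((κ : ℂ) + y * I))))) +
        2 * π * ∑ c ∈ S, r c * (mellin f (-(c : ℂ)) * conj (mellin f' (-(c : ℂ)))) := by
  have hS' : ∀ c ∈ S, κ < c := fun c hc => (hS c hc).1
  obtain ⟨K, hK⟩ := exists_norm_twoTermIntegrand_le_div_sq hf hfs hf0 hf' hf's hf'0 ρ g hσ₀ hUo hUs hs hS' hB
  exact integral_vertical_eq_integral_vertical_add_sum_residues (F := fun z : ℂ => mellin f (-z) * (g * conj (mellin f' (conj z - ρ)) + s z * conj (mellin f' (-conj z))))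
    hσ₀ S hS hUo hUs (differentiableOn_twoTermIntegrand hf hfs hf0 hf' hf's hf'0 ρ g hs)
    (fun c => r c * (mellin f (-(c : ℂ)) * conj (mellin f' (-(c : ℂ))))) (fun c hc => tendsto_sub_mul_twoTermIntegrand hf hfs hf0 hf' hf's hf'0 ρ g (hr c hc))
    (integrable_twoTermIntegrand_vertical hf hfs hf0 hf' hf's hf'0 ρ g hσ₀ hUo hUs hs hS' hB (le_refl _) hσ₀.le (fun c hc => (hS c hc).1.ne))
    (integrable_twoTermIntegrand_vertical hf hfs hf0 hf' hf's hf'0 ρ g hσ₀ hUo hUs hs hS' hB hσ₀.le le_rfl (fun c hc => (hS c hc).2.ne')) hK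

end Integrand

/-! ## §3 HEAD: the two-term inner-product formula moved from `Re z = σ₀` to the axis `Re z = κ` -/

/-- **HEAD — THE TWO-TERM INNER-PRODUCT FORMULA OF A PSEUDO-EISENSTEIN FAMILY MOVED TO AN ARBITRARY AXIS ACROSS FINITELY MANY SIMPLE REAL POLES (ON LETTERS).**  Data:
`f, f′ ∈ C²_c((0,∞))`; reals `κ < σ₀` (the axis and the line of absolute convergence); `ρ ∈ ℂ` (the reflection point, `= 2κ` in the applications: `(κ, ρ) = (½, 1)` for `U(1,1)`,
`(1, 2)` for `U(2,1)`); `g ∈ ℂ` (the Gram constant of the diagonal bracket); the axis scalar `s` with LETTERS `hs` (holomorphic on an open `U ⊇ {κ ≤ Re z ≤ σ₀}` off a finset `S` of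
REAL poles in `(κ, σ₀)`), `hr` (`(z − c)s(z) → r_c` at each `c ∈ S`), `hB` (`‖s z‖ ≤ B` on `κ < Re z ≤ σ₀, |Im z| ≥ 1`); and the two-term identity
`hIP : IP = C·((2π)⁻¹·∫_ℝ F(σ₀+iy) dy)` with `F(z) = f̃(−z)·(g·conj(mellin f′ (z̄ − ρ)) + s(z)·conj(mellin f′ (−z̄)))` spelled verbatim.  CONCLUSION:
**`IP = C·(Σ_{c ∈ S} r_c·f̃(−c)·conj(mellin f′ (−c))) + C·((2π)⁻¹·∫_ℝ F(κ+iy) dy)`**; `y ↦ F(κ+iy) ∈ L¹` by `integrable_twoTermIntegrand_vertical`.  `(κ, ρ, g) = (½, 1, 1)` is ★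
T4b-multi's head (spelling `z̄ − 1` for `−(1 − z̄)`); `(κ, ρ) = (1, 2)`, `σ₀ > 2` is the `U(2,1)` shift of census PB-2. [cite: MoeglinWaldspurger1995, II.2.1, II.2.4, IV.1.11]
[cite: Titchmarsh1939, §3.12] -/
theorem pseudoEisenstein_contourShift_axis_of_letters {f f' : ℝ → ℂ} (hf : ContDiff ℝ 2 f) (hfs : HasCompactSupport f) (hf0 : tsupport f ⊆ Ioi 0)
    (hf' : ContDiff ℝ 2 f') (hf's : HasCompactSupport f') (hf'0 : tsupport f' ⊆ Ioi 0) {κ σ₀ : ℝ} (hσ₀ : κ < σ₀) (ρ g : ℂ)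
    {s : ℂ → ℂ} {U : Set ℂ} (hUo : IsOpen U) (hUs : {z : ℂ | κ ≤ z.re ∧ z.re ≤ σ₀} ⊆ U)
    (S : Finset ℝ) (hS : ∀ c ∈ S, κ < c ∧ c < σ₀) (hs : DifferentiableOn ℂ s (U \ ((S.image fun c : ℝ => (c : ℂ)) : Set ℂ)))
    (r : ℝ → ℂ) (hr : ∀ c ∈ S, Tendsto (fun z : ℂ => (z - c) * s z) (𝓝[≠] (c : ℂ)) (𝓝 (r c)))
    {B : ℝ} (hB : ∀ z : ℂ, κ < z.re → z.re ≤ σ₀ → 1 ≤ |z.im| → ‖s z‖ ≤ B)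
    {IP C : ℂ} (hIP : IP = C * ((((2 * π)⁻¹ : ℝ) : ℂ) * ∫ y : ℝ, mellin f (-((σ₀ : ℂ) + y * I)) *
      (g * conj (mellin f' (conj ((σ₀ : ℂ) + y * I) - ρ)) + s ((σ₀ : ℂ) + y * I) * conj (mellin f' (-conj ((σ₀ : ℂ) + y * I)))))) :
    IP = C * (∑ c ∈ S, r c * (mellin f (-(c : ℂ)) * conj (mellin f' (-(c : ℂ))))) +
      C * ((((2 * π)⁻¹ : ℝ) : ℂ) * ∫ y : ℝ, mellin f (-((κ : ℂ) + y * I)) *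
        (g * conj (mellin f' (conj ((κ : ℂ) + y * I) - ρ)) + s ((κ : ℂ) + y * I) * conj (mellin f' (-conj ((κ : ℂ) + y * I))))) := by
  rw [hIP, integral_twoTermIntegrand_eq_add_sum_residues hf hfs hf0 hf' hf's hf'0 ρ g hσ₀ hUo hUs hs hS hr hB]
  have hπ : ((((2 * π)⁻¹ : ℝ) : ℂ)) * (2 * π) = 1 := by
    push_cast
    exact inv_mul_cancel₀ (mul_ne_zero two_ne_zero (ofReal_ne_zero.2 Real.pi_pos.ne'))
  calc C * ((((2 * π)⁻¹ : ℝ) : ℂ) * ((∫ y : ℝ, mellin f (-((κ : ℂ) + y * I)) *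
          (g * conj (mellin f' (conj ((κ : ℂ) + y * I) - ρ)) + s ((κ : ℂ) + y * I) * conj (mellin f' (-conj ((κ : ℂ) + y * I))))) +
          2 * π * ∑ c ∈ S, r c * (mellin f (-(c : ℂ)) * conj (mellin f' (-(c : ℂ))))))
      = C * (((((2 * π)⁻¹ : ℝ) : ℂ)) * (2 * π)) * (∑ c ∈ S, r c * (mellin f (-(c : ℂ)) * conj (mellin f' (-(c : ℂ))))) +
          C * ((((2 * π)⁻¹ : ℝ) : ℂ) * ∫ y : ℝ, mellin f (-((κ : ℂ) + y * I)) *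
            (g * conj (mellin f' (conj ((κ : ℂ) + y * I) - ρ)) + s ((κ : ℂ) + y * I) * conj (mellin f' (-conj ((κ : ℂ) + y * I))))) := by
        ring
    _ = _ := by rw [hπ, mul_one]

end Summit.HodgeConjecture.HodgeConjecture.Cruxes.H413.K2E1PseudoEisensteinContourShiftAxisGeneric

end
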